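import Summits.RiemannHypothesis.RiemannHypothesis.Theorems.ThetaTier2RowSound
import HarnessLib

/-!
# THETA tier-2 kernel rows — twin primes `3467 ≤ q ≤ 4127` (module 6 of 13; cc-s2-1, WEIL typing lane; RH-FREE bookkeeping)

Data module of the tier-2 theta certificate (THETA-CERT-cc6 §E; HOME/cc-s2-1/gen22/TIER2-KERNEL-SPEC.md; soundness chain
`ThetaTier2Check … ThetaTier2RowSound`): the rows `(q, q⁺, m, δ·10¹², menu, k)` — `m = 5`, `δ = ⌊0.98·δ_q·10¹²⌋/10¹²` with
`δ_q = ½ log(q⁺/q)`, menu `0` = thin seed `(1/20, 19/20, 1)`, `η′ = 1/100` (menu `1` = `(1/4, 3/5, 1)`, `η′ = 1/20` for `q = 179, 191`),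
`t₀ = 2⁻¹⁵`; `K = 6`, `τ = 1/100`, `D = 3`, `W_l = 4`, `J = 64` — for the twin primes `3467 ≤ q ≤ 4127` in the range of the route item
`stmt-RiemannHypothesis-19172` (`WallsTenKTwin`, `route-RiemannHypothesis-WeilSemilocal`), checked in the kernel by `Row2.check`
(`decide +kernel`, ≈ 14 s per row), and the resulting REAL statements `T2Valid r.inp r.real ∧ r.RowFacts` (`Row2.check_sound`) that the
E-side assembly turns into `UC(q)`.  Nothing here bears on the truth of RH.
-/

set_option linter.dupNamespace false  -- the mandated namespace repeats `RiemannHypothesis`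

namespace Summit.RiemannHypothesis.RiemannHypothesis.Theorems.ThetaTier2

/-- Twin rows `3467 ≤ q ≤ 3821` (8 rows). [this cell, TIER2-KERNEL-SPEC §4] -/
def twinRows06_1 : List Row2 := [
  ⟨3467, 3469, 5, 282583629, 0, 15⟩, ⟨3527, 3529, 5, 277777785, 0, 15⟩, ⟨3539, 3541, 5, 276836165, 0, 15⟩, ⟨3557, 3559, 5, 275435645, 0, 15⟩,
  ⟨3581, 3583, 5, 273590180, 0, 15⟩, ⟨3671, 3673, 5, 266884538, 0, 15⟩, ⟨3767, 3769, 5, 260084931, 0, 15⟩, ⟨3821, 3823, 5, 256410262, 0, 15⟩ ]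

/-- The kernel verdict for `twinRows06_1`. [this cell, THETA-CERT-cc6 §E6] -/
theorem twinRows06_1_check : twinRows06_1.all Row2.check = true := by
  decide +kernel

/-- (K1)–(K7) and the row facts at every row of `twinRows06_1`. [this cell, THETA-CERT-cc6 §E6] -/
theorem twinRows06_1_valid : ∀ r ∈ twinRows06_1, T2Valid r.inp r.real ∧ r.RowFacts :=
  fun r hr => r.check_sound (List.all_eq_true.1 twinRows06_1_check r hr)

/-- Twin rows `3851 ≤ q ≤ 4127` (8 rows). [this cell, TIER2-KERNEL-SPEC §4] -/
def twinRows06_2 : List Row2 := [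
  ⟨3851, 3853, 5, 254413297, 0, 15⟩, ⟨3917, 3919, 5, 250127621, 0, 15⟩, ⟨3929, 3931, 5, 249363873, 0, 15⟩, ⟨4001, 4003, 5, 244877566, 0, 15⟩,
  ⟨4019, 4021, 5, 243781099, 0, 15⟩, ⟨4049, 4051, 5, 241975313, 0, 15⟩, ⟨4091, 4093, 5, 239491695, 0, 15⟩, ⟨4127, 4129, 5, 237403105, 0, 15⟩ ]

/-- The kernel verdict for `twinRows06_2`. [this cell, THETA-CERT-cc6 §E6] -/
theorem twinRows06_2_check : twinRows06_2.all Row2.check = true := by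
  decide +kernel

/-- (K1)–(K7) and the row facts at every row of `twinRows06_2`. [this cell, THETA-CERT-cc6 §E6] -/
theorem twinRows06_2_valid : ∀ r ∈ twinRows06_2, T2Valid r.inp r.real ∧ r.RowFacts :=
  fun r hr => r.check_sound (List.all_eq_true.1 twinRows06_2_check r hr)

end Summit.RiemannHypothesis.RiemannHypothesis.Theorems.ThetaTier2
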